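import Literature.Probability.RandomPlanarGeometry.HexParafermionProofs
import HarnessLib

/-!
# Rigidity of the winding of self-avoiding walks between boundary mid-edges

Topic `Literature/Probability/RandomPlanarGeometry`; theorems only (no new definition), on top of
`HexSAWWinding.lean` (turns `turn`, `pturn`, `cturn`, winding numbers `wnd`, the loop lemma
`cturn_eq_neg_six_mul_turn`) and `HexParafermionProofs.lean` (charts and codes of walks between
mid-edges). Source: H. Duminil-Copin, S. Smirnov, *The connective constant of the honeycomb lattice
equals `√(2+√2)`*, Ann. of Math. 175 (2012) 1653–1665, arXiv:1007.0575: in a simply connected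
domain the winding `W_γ(a, b)` of a self-avoiding walk between two BOUNDARY mid-edges does not
depend on the walk — used in the proof of Lemma 2 (p. 5: "the winding of any self-avoiding walk
from `a` to the bottom part of `α` is `-π` while the winding to the top part is `π` … the winding
from `a` to any half-edge in `β` (resp. `ε` and `ε̄`) is `0` (resp. `2π/3` and `-2π/3`)") and, in
its loop form, in the proof of Lemma 1 (p. 4: "we used the fact that `a` is on the boundary and
`Ω` is simply connected"). The strip instances are `HexSAWBoundaryWinding.lean`; this file proves
the general statement.

## Main results

* `HV.pturn_eq_pturn_of_paths` — **path rigidity in the coordinate model**: for a finite vertex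
  set `V` every vertex off which is joined, off `V`, to an up vertex to the right of `V`
  (coordinate form of "connected complement"), an entrance dart `s → v₀` (`s ∉ V ∋ v₀`) and an
  exit dart `v_b → e` (`e ∉ V`), all self-avoiding paths `P` of `V` from `v₀` to `v_b` have the
  same total turning `pturn (s :: P ++ [e])`.
* `HexMidEdgeSAW.winding_eq_pturn_code` — the winding of a nontrivial walk between mid-edges is
  `(π/3) · pturn` of its code (extracted from the proof of `HexMidEdgeSAW.weight_eq_pwt`).
* `HexMidEdgeSAW.winding_eq_of_mem_boundary` — **rigidity**: for `Λ` simply connected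
  (`hexDomainSimplyConnected`) and `a, b ∈ ∂Ω` (`hexDomainBoundary`), any two walks
  `γ, γ' : HexMidEdgeSAW Λ a b` have `γ.winding = γ'.winding`.

## Proof of the path rigidity

Strong induction on `|V|`. If the two paths share their first step, remove `v₀` (the complement
property survives: `HV.far_of_sdiff`) and conclude by induction with the new entrance `v₀ → p₁`.
Otherwise let `m` be the first vertex of `P` after `v₀` lying on `Q` (`HV.exists_first_mem_split`);
the arc of `P` from `v₀` to `m` followed by the reversed arc of `Q` from `m` to `v₀` is a simple
cycle of `V`. The loop lemma applied at `v₀`, seen from `s` — outside the cycle, because `s` is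
joined off `V` to the far right, along which path the winding number is constant and finally `0`
(`HV.wnd_rightFace_eq_zero_of_far`) — gives `cturn = -6 τ`, `τ = turn s v₀ p₁`; applied at `m`,
seen from the vertex `z` following `m` on `Q` (outside as well: the rest of `Q` leads to `e ∉ V`
and then off `V` to the far right), it pins `turn z m · = τ`. The tails of `P` and `Q` from `m`
live in `V` minus the first arc of `P`, a smaller set with the complement property, entered by the
dart into `m` along `P`; by induction their turnings agree. Splitting the turning number of the
cycle along its two arcs (`HV.cturn_cons_append_cons`) and the two totals at `m`
(`HV.pturn_append_cons_getLast`), the identities `turn x m y = -turn x m y'` at the trivalent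
vertices `v₀` and `m` (`HV.turn_eq_neg_turn_of_ne`) balance the books.
-/

noncomputable section

open Finset Literature.Probability.LatticeModels Literature.Probability.Percolation

namespace Literature.Probability.RandomPlanarGeometry.SAW

namespace HV

/-! ### Turns at a trivalent vertex -/

/-- **At a vertex of `ℍ` the turns from one neighbour towards the two other neighbours are
opposite** (`±1`): entering from `x`, one exit is a left turn and the other a right turn.
[folklore] -/
theorem turn_eq_neg_turn_of_ne {m x y y' : HV} (hx : hvGraph.Adj m x) (hy : hvGraph.Adj m y)
    (hy' : hvGraph.Adj m y') (hyx : y ≠ x) (hy'x : y' ≠ x) (hyy' : y ≠ y') :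
    turn x m y = -turn x m y' := by
  rcases adj_cases hx hy with rfl | rfl | rfl
  · exact absurd rfl hyx
  · rcases adj_cases hx hy' with rfl | rfl | rfl
    · exact absurd rfl hy'x
    · exact absurd rfl hyy'
    · rw [turn_ccw hx, turn_cw hx]
  · rcases adj_cases hx hy' with rfl | rfl | rfl
    · exact absurd rfl hy'x
    · rw [turn_ccw hx, turn_cw hx]; norm_num
    · exact absurd rfl hyy'

/-! ### List bookkeeping -/

/-- The head of `X ++ v :: A` does not depend on `A`. [folklore] -/
theorem head_append_cons {α : Type*} (X : List α) (v : α) (A : List α) :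
    (X ++ v :: A).head (by simp) = (X ++ [v]).head (by simp) := by
  cases X <;> rfl

/-- **First entry in another list**: a list meeting `Q` splits as `A ++ m :: B` with `m ∈ Q` and
`A` avoiding `Q`. [folklore] -/
theorem exists_first_mem_split {α : Type*} [DecidableEq α] :
    ∀ (P Q : List α), (∃ x ∈ P, x ∈ Q) →
      ∃ (A : List α) (m : α) (B : List α), P = A ++ m :: B ∧ m ∈ Q ∧ ∀ x ∈ A, x ∉ Q
  | [], Q, h => by simp at h
  | x :: P, Q, h => by
    by_cases hx : x ∈ Q
    · exact ⟨[], x, P, rfl, hx, fun y hy => by simp at hy⟩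
    · have h' : ∃ y ∈ P, y ∈ Q := by
        obtain ⟨y, hy, hyQ⟩ := h
        rcases List.mem_cons.1 hy with rfl | hy
        · exact absurd hyQ hx
        · exact ⟨y, hy, hyQ⟩
      obtain ⟨A, m, B, rfl, hm, hA⟩ := exists_first_mem_split P Q h'
      refine ⟨x :: A, m, B, rfl, hm, fun y hy => ?_⟩
      rcases List.mem_cons.1 hy with rfl | hy
      · exact hx
      · exact hA y hy

/-! ### Splitting turn sums -/

/-- Splitting the turn sum of a path at a vertex `m`: the turns up to `m` (exclusive) plus the
turns from `m` on, the latter seen from the vertex before `m`. [folklore] -/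
theorem pturn_append_cons_getLast (L₁ L₂ : List HV) (h : L₁ ≠ []) (m : HV) :
    pturn (L₁ ++ m :: L₂) = pturn (L₁ ++ [m]) + pturn (L₁.getLast h :: m :: L₂) := by
  obtain ⟨L₀, l, rfl⟩ : ∃ L₀ l, L₁ = L₀ ++ [l] := ⟨_, _, (List.dropLast_append_getLast h).symm⟩
  rw [List.getLast_append_singleton, List.append_assoc, List.singleton_append,
    pturn_append_cons_cons, List.append_assoc]
  rfl

/-- Peeling the first turn of a path with at least three vertices written with an appended
tail. [folklore] -/
theorem pturn_cons_cons_append (a b : HV) (L : List HV) (hL : L ≠ []) :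
    pturn (a :: b :: L) = turn a b (L.head hL) + pturn (b :: L) := by
  obtain ⟨c, L', rfl⟩ := List.exists_cons_of_ne_nil hL
  rfl

/-- **The turning number of a cycle made of two arcs** from `v₀` to `m` — the arc `v₀ :: A ++ [m]`
and the reverse of the arc closing through `R` — is the turn at `v₀`, plus the turns along the
first arc, plus the turns from `m` back to `v₀` along `R` seen from the vertex before `m`.
[folklore] -/
theorem cturn_cons_append_cons (v₀ m : HV) (A R : List HV) :
    cturn (v₀ :: (A ++ m :: R)) =
      turn ((m :: R).getLast (List.cons_ne_nil _ _)) v₀ ((A ++ [m]).head (by simp)) +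
        pturn (v₀ :: (A ++ [m])) +
        pturn ((v₀ :: A).getLast (List.cons_ne_nil _ _) :: m :: (R ++ [v₀])) := by
  set x₁ : HV := (A ++ [m]).head (by simp) with hx₁
  set X : HV := (v₀ :: A).getLast (List.cons_ne_nil _ _) with hX
  -- the closing segment `take 2`
  have htake : (v₀ :: (A ++ m :: R)).take 2 = [v₀, x₁] := by
    rw [hx₁]; cases A <;> rfl
  have e1 : v₀ :: (A ++ m :: R) ++ [v₀, x₁] = (v₀ :: A) ++ m :: (R ++ [v₀, x₁]) := by simp
  have s1 : pturn ((v₀ :: A) ++ m :: (R ++ [v₀, x₁])) =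
      pturn ((v₀ :: A) ++ [m]) + pturn (X :: m :: (R ++ [v₀, x₁])) :=
    pturn_append_cons_getLast (v₀ :: A) (R ++ [v₀, x₁]) (List.cons_ne_nil _ _) m
  have e2 : X :: m :: (R ++ [v₀, x₁]) = (X :: m :: R) ++ v₀ :: [x₁] := by simp
  have s2 : pturn ((X :: m :: R) ++ v₀ :: [x₁]) =
      pturn ((X :: m :: R) ++ [v₀]) +
        pturn ((X :: m :: R).getLast (List.cons_ne_nil _ _) :: v₀ :: [x₁]) :=
    pturn_append_cons_getLast (X :: m :: R) [x₁] (List.cons_ne_nil _ _) v₀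
  have e3 : (X :: m :: R).getLast (List.cons_ne_nil _ _) = (m :: R).getLast (List.cons_ne_nil _ _) :=
    List.getLast_cons (List.cons_ne_nil _ _)
  have e4 : (X :: m :: R) ++ [v₀] = X :: m :: (R ++ [v₀]) := by simp
  have e5 : (v₀ :: A) ++ [m] = v₀ :: (A ++ [m]) := rfl
  rw [cturn, htake, e1, s1, e2, s2, e3, e4, e5, pturn_cons₃, pturn_two, add_zero]
  ring

/-! ### Outside vertices -/

variable {l : List HV}

/-- A face to the left of a dart leaving an up vertex beyond the cycle (all first coordinates of
the cycle `≤ N <` that of the vertex) has winding number `0`. [folklore] -/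
theorem wnd_leftFace_eq_zero_of_fst_lt {N : ℤ} (hN : ∀ w ∈ l, w.1 ≤ N) {a b : ℤ} (ha : N < a)
    {g : HV} (hg : hvGraph.Adj (a, b, false) g) : wnd l (leftFace (a, b, false) g) = 0 := by
  refine wnd_eq_zero_of_fst_ne fun w hw => ?_
  have hw1 := hN w hw
  rcases leftFace_fst_of_adj hg with h | h <;> rw [h] <;> omega

/-- **Outside vertices**: if a vertex `z` is joined to an up vertex lying to the right of the
cycle by a lattice path all of whose vertices are off the cycle, then every face at `z` has
winding number `0` (version for the face to the left of a dart at `z`). The winding number is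
constant along the path (`wnd_rightFace_pdarts_eq`) and vanishes beyond the cycle.
[cite: DuminilCopinSmirnov2012, §2 ("simply connected, i.e. having a connected complement")] -/
theorem wnd_face_eq_zero_of_far (hl : ∀ d ∈ cdarts l, hvGraph.Adj d.1 d.2) {N : ℤ}
    (hN : ∀ w ∈ l, w.1 ≤ N) (W : List HV) (hW : W ≠ []) (hc : W.IsChain hvGraph.Adj)
    (hav : ∀ w ∈ W, w ∉ l) (hfar : N < (W.getLast hW).1) (hup : (W.getLast hW).2.2 = false)
    {t : HV} (ht : hvGraph.Adj (W.head hW) t) : wnd l (leftFace (W.head hW) t) = 0 := by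
  obtain ⟨z, W', rfl⟩ := List.exists_cons_of_ne_nil hW
  have hz : z ∉ l := hav z List.mem_cons_self
  simp only [List.head_cons] at ht ⊢
  rcases eq_or_ne W' [] with rfl | hW'
  · -- `z` itself is far
    obtain ⟨a, b, c⟩ := z
    simp only [List.getLast_singleton] at hfar hup
    subst hup
    exact wnd_leftFace_eq_zero_of_fst_lt hN hfar ht
  · -- propagate along `W` from the first dart to the last dart
    obtain ⟨W₀, y, hWy⟩ : ∃ W₀ y, W' = W₀ ++ [y] := ⟨_, _, (List.dropLast_append_getLast hW').symm⟩
    have hlast : (z :: W').getLast (List.cons_ne_nil _ _) = y := by simp [hWy]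
    rw [hlast] at hfar hup
    obtain ⟨w₁, W'', hw₁⟩ := List.exists_cons_of_ne_nil hW'
    have hd₁ : (z, w₁) ∈ pdarts (z :: W') := by rw [hw₁, pdarts_cons_cons]; exact List.mem_cons_self
    have hd₂ : ((z :: W₀).getLast (List.cons_ne_nil _ _), y) ∈ pdarts (z :: W') := by
      rw [hWy, ← List.cons_append, pdarts_append_singleton _ (List.cons_ne_nil _ _)]
      exact List.mem_append_right _ (List.mem_singleton_self _)
    have hint : ∀ x ∈ (z :: W').tail.dropLast, x ∉ l := fun x hx =>
      hav x (List.mem_cons_of_mem _ ((List.dropLast_sublist W').subset hx))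
    have key := wnd_rightFace_pdarts_eq hl (z :: W') hc hint _ hd₁ _ hd₂
    -- the last dart ends at the far up vertex `y`
    have hg : hvGraph.Adj ((z :: W₀).getLast (List.cons_ne_nil _ _)) y :=
      adj_of_mem_pdarts hc _ hd₂
    obtain ⟨a, b, c⟩ := y
    simp only at hup
    subst hup
    have hfar0 : wnd l (rightFace ((z :: W₀).getLast (List.cons_ne_nil _ _)) (a, b, false)) = 0 :=
      wnd_leftFace_eq_zero_of_fst_lt hN hfar hg.symm
    simp only [hfar0] at key
    -- the faces at `z` all agree (`z ∉ l`)
    have hzw₁ : hvGraph.Adj z w₁ := by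
      rw [hw₁] at hc; exact (List.isChain_cons_cons.1 hc).1
    rw [wnd_faces_at_eq hl hz ht hzw₁]
    exact key

/-- Outside vertices, version for the face to the right of a dart at `z`. [folklore] -/
theorem wnd_rightFace_eq_zero_of_far (hl : ∀ d ∈ cdarts l, hvGraph.Adj d.1 d.2) {N : ℤ}
    (hN : ∀ w ∈ l, w.1 ≤ N) (W : List HV) (hW : W ≠ []) (hc : W.IsChain hvGraph.Adj)
    (hav : ∀ w ∈ W, w ∉ l) (hfar : N < (W.getLast hW).1) (hup : (W.getLast hW).2.2 = false)
    {t : HV} (ht : hvGraph.Adj (W.head hW) t) : wnd l (rightFace (W.head hW) t) = 0 := by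
  rw [← wnd_faces_at_eq hl (hav _ (List.head_mem hW)) ht ht]
  exact wnd_face_eq_zero_of_far hl hN W hW hc hav hfar hup ht

/-! ### The complement property under removal of an entrance arc -/

/-- Removing from `V` an arc `R` entered from a vertex `s ∉ V` keeps the complement joined to
the far right: vertices of `R` escape backwards along `R` to `s`. [folklore] -/
theorem far_of_sdiff {V : Finset HV} {N : ℤ}
    (hconn : ∀ x ∉ V, ∃ (W : List HV) (hW : W ≠ []), W.IsChain hvGraph.Adj ∧ W.head hW = x ∧
      (∀ w ∈ W, w ∉ V) ∧ N < (W.getLast hW).1 ∧ (W.getLast hW).2.2 = false)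
    {s : HV} (hs : s ∉ V) (R : List HV) (hR : R ≠ []) (hRc : R.IsChain hvGraph.Adj)
    (hsR : hvGraph.Adj s (R.head hR)) :
    ∀ x ∉ V \ R.toFinset, ∃ (W : List HV) (hW : W ≠ []), W.IsChain hvGraph.Adj ∧ W.head hW = x ∧
      (∀ w ∈ W, w ∉ V \ R.toFinset) ∧ N < (W.getLast hW).1 ∧ (W.getLast hW).2.2 = false := by
  intro x hx
  by_cases hxV : x ∈ V
  · have hxR : x ∈ R := by
      by_contra h
      exact hx (Finset.mem_sdiff.2 ⟨hxV, fun h' => h (List.mem_toFinset.1 h')⟩)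
    obtain ⟨R₁, R₂, rfl⟩ := List.append_of_mem hxR
    obtain ⟨Ws, hWs, hcs, hhs, havs, hfars, hups⟩ := hconn s hs
    obtain ⟨Ws', rfl⟩ : ∃ Ws', Ws = s :: Ws' := by
      obtain ⟨w, Ws', rfl⟩ := List.exists_cons_of_ne_nil hWs
      exact ⟨Ws', by rw [List.head_cons] at hhs; rw [hhs]⟩
    refine ⟨(R₁ ++ [x]).reverse ++ s :: Ws', by simp, ?_, ?_, ?_, ?_, ?_⟩
    · -- chain
      have h1 : (R₁ ++ [x]).IsChain hvGraph.Adj := (List.isChain_split.1 hRc).1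
      have h1' : (R₁ ++ [x]).reverse.IsChain hvGraph.Adj :=
        List.isChain_reverse.2 (h1.imp fun a b h => h.symm)
      refine List.IsChain.append h1' hcs fun a ha b hb => ?_
      rw [List.getLast?_eq_getLast_of_ne_nil (by simp), Option.mem_some_iff] at ha
      rw [List.head?_cons, Option.mem_some_iff] at hb
      subst ha hb
      rw [List.getLast_reverse]
      have : (R₁ ++ [x]).head (by simp) = (R₁ ++ x :: R₂).head hR := (head_append_cons R₁ x R₂).symm
      rw [this]
      exact hsR.symm
    · simp
    · intro w hw
      rw [List.mem_append] at hw
      rcases hw with hw | hw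
      · rw [List.mem_reverse] at hw
        intro hw'
        rw [Finset.mem_sdiff, List.mem_toFinset] at hw'
        refine hw'.2 ?_
        rw [List.mem_append] at hw ⊢
        rcases hw with hw | hw
        · exact Or.inl hw
        · exact Or.inr (by simp at hw; simp [hw])
      · exact fun hw' => havs w hw (Finset.mem_sdiff.1 hw').1
    · rwa [List.getLast_append_of_ne_nil _ (List.cons_ne_nil _ _)]
    · rwa [List.getLast_append_of_ne_nil _ (List.cons_ne_nil _ _)]
  · obtain ⟨W, hW, hc, hh, hav, hfar, hup⟩ := hconn x hxV
    exact ⟨W, hW, hc, hh, fun w hw hw' => hav w hw (Finset.mem_sdiff.1 hw').1, hfar, hup⟩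


/-! ### Path rigidity -/

/-- **Rigidity of the turning of self-avoiding paths between boundary darts.** Let `V` be a
finite vertex set of `ℍ` every vertex off which is joined, off `V`, to an up vertex to the right
of `V` (coordinate form of "`V` has a connected complement"); let `s → v₀` be an entrance dart
(`s ∉ V`, `v₀ ∈ V`) and `v_b → e` an exit dart (`e ∉ V`). Then for any two self-avoiding paths
`v₀ :: P'`, `v₀ :: Q'` of `V` from `v₀` to `v_b` the total turnings of `s, v₀, P', e` and of
`s, v₀, Q', e` coincide. (DCS use the instances "the winding of any self-avoiding walk from `a`
to the bottom part of `α` is `-π` …" in the strip, and the loop case in the proof of Lemma 1.)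
[cite: DuminilCopinSmirnov2012, §3 proof of Lemma 2] -/
theorem pturn_eq_pturn_of_paths :
    ∀ (n : ℕ) (V : Finset HV), V.card = n → ∀ (N : ℤ), (∀ v ∈ V, v.1 ≤ N) →
    (∀ x ∉ V, ∃ (W : List HV) (hW : W ≠ []), W.IsChain hvGraph.Adj ∧ W.head hW = x ∧
      (∀ w ∈ W, w ∉ V) ∧ N < (W.getLast hW).1 ∧ (W.getLast hW).2.2 = false) →
    ∀ (s v₀ vb e : HV), s ∉ V → e ∉ V → hvGraph.Adj s v₀ → hvGraph.Adj vb e →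
    ∀ (P' Q' : List HV),
      (v₀ :: P').IsChain hvGraph.Adj → (v₀ :: P').Nodup → (∀ x ∈ v₀ :: P', x ∈ V) →
      (v₀ :: P').getLast (List.cons_ne_nil _ _) = vb →
      (v₀ :: Q').IsChain hvGraph.Adj → (v₀ :: Q').Nodup → (∀ x ∈ v₀ :: Q', x ∈ V) →
      (v₀ :: Q').getLast (List.cons_ne_nil _ _) = vb →
      pturn (s :: v₀ :: (P' ++ [e])) = pturn (s :: v₀ :: (Q' ++ [e])) := by
  intro n
  induction n using Nat.strong_induction_on with
  | _ n ih =>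
  intro V hV N hN hconn s v₀ vb e hs he hsv hbe P' Q' cP nP sP lP cQ nQ sQ lQ
  have hv₀ : v₀ ∈ V := sP v₀ List.mem_cons_self
  have hv₀P : v₀ ∉ P' := (List.nodup_cons.1 nP).1
  have hv₀Q : v₀ ∉ Q' := (List.nodup_cons.1 nQ).1
  -- trivial paths
  rcases eq_or_ne P' [] with rfl | hP'
  · have hvb : vb = v₀ := by simpa using lP.symm
    subst hvb
    have hQ' : Q' = [] := by
      by_contra hQ'
      rw [List.getLast_cons hQ'] at lQ
      exact hv₀Q (lQ ▸ List.getLast_mem hQ')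
    subst hQ'
    rfl
  have hQ' : Q' ≠ [] := by
    rintro rfl
    have hvb : vb = v₀ := by simpa using lQ.symm
    rw [hvb, List.getLast_cons hP'] at lP
    exact hv₀P (lP ▸ List.getLast_mem hP')
  -- the first vertex of `P'` on `Q`
  have hvbP : vb ∈ P' := by rw [List.getLast_cons hP'] at lP; exact lP ▸ List.getLast_mem hP'
  have hvbQ : vb ∈ v₀ :: Q' := lQ ▸ List.getLast_mem _
  obtain ⟨A, m, B, rfl, hmQ, hAQ⟩ := exists_first_mem_split P' (v₀ :: Q') ⟨vb, hvbP, hvbQ⟩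
  have hmv₀ : m ≠ v₀ := fun h => hv₀P (h ▸ by simp)
  have hmQ' : m ∈ Q' := (List.mem_cons.1 hmQ).resolve_left hmv₀
  obtain ⟨C, D, rfl⟩ := List.append_of_mem hmQ'
  -- bookkeeping: membership in `V`
  have hmV : m ∈ V := sP m (by simp)
  have hAV : ∀ x ∈ A, x ∈ V := fun x hx => sP x (by simp [hx])
  have hBV : ∀ x ∈ B, x ∈ V := fun x hx => sP x (by simp [hx])
  have hCV : ∀ x ∈ C, x ∈ V := fun x hx => sQ x (by simp [hx])
  have hDV : ∀ x ∈ D, x ∈ V := fun x hx => sQ x (by simp [hx])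
  -- bookkeeping: no repetitions
  have nP' : (A ++ m :: B).Nodup := (List.nodup_cons.1 nP).2
  have nQ'' : (C ++ m :: D).Nodup := (List.nodup_cons.1 nQ).2
  have hv₀A : v₀ ∉ A := fun h => hv₀P (by simp [h])
  have hv₀B : v₀ ∉ B := fun h => hv₀P (by simp [h])
  have hv₀C : v₀ ∉ C := fun h => hv₀Q (by simp [h])
  have hv₀D : v₀ ∉ D := fun h => hv₀Q (by simp [h])
  have hmA : m ∉ A := fun h => hAQ m h hmQ
  have nmB : (m :: B).Nodup := nP'.of_append_right
  have nmD : (m :: D).Nodup := nQ''.of_append_right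
  have hmB : m ∉ B := (List.nodup_cons.1 nmB).1
  have hmD : m ∉ D := (List.nodup_cons.1 nmD).1
  have hmC : m ∉ C := by
    have := List.nodup_middle.1 nQ''
    exact fun h => (List.nodup_cons.1 this).1 (List.mem_append_left _ h)
  have nA : A.Nodup := nP'.of_append_left
  have nC : C.Nodup := nQ''.of_append_left
  have hAC : ∀ x ∈ A, x ∉ C := fun x hx h => hAQ x hx (by simp [h])
  have hAD : ∀ x ∈ A, x ∉ D := fun x hx h => hAQ x hx (by simp [h])
  have hCD : ∀ x ∈ C, x ∉ D := by
    have := List.nodup_middle.1 nQ''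
    have hd := (List.nodup_cons.1 this).2
    exact fun x hx h => (List.nodup_append'.1 hd).2.2 hx h
  have hBA : ∀ x ∈ B, x ∉ A := by
    have := List.nodup_middle.1 nP'
    have hd := (List.nodup_cons.1 this).2
    exact fun x hx h => (List.nodup_append'.1 hd).2.2 h hx
  -- bookkeeping: chains
  have cPm : (v₀ :: (A ++ [m])).IsChain hvGraph.Adj := (List.isChain_cons_split.1 cP).1
  have cmB : (m :: B).IsChain hvGraph.Adj := (List.isChain_cons_split.1 cP).2
  have cQm : (v₀ :: (C ++ [m])).IsChain hvGraph.Adj := (List.isChain_cons_split.1 cQ).1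
  have cmD : (m :: D).IsChain hvGraph.Adj := (List.isChain_cons_split.1 cQ).2
  -- the last vertices
  have lmB : (m :: B).getLast (List.cons_ne_nil _ _) = vb := by
    rw [← lP]; simp [List.getLast_append_of_ne_nil _ (List.cons_ne_nil m B)]
  have lmD : (m :: D).getLast (List.cons_ne_nil _ _) = vb := by
    rw [← lQ]; simp [List.getLast_append_of_ne_nil _ (List.cons_ne_nil m D)]
  -- the chains `m :: B ++ [e]`, `m :: D ++ [e]`
  have cmBe : (m :: (B ++ [e])).IsChain hvGraph.Adj := by
    rw [← List.cons_append]
    refine List.IsChain.append cmB (List.isChain_singleton e) fun x hx y hy => ?_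
    rw [List.getLast?_eq_getLast_of_ne_nil (List.cons_ne_nil _ _), Option.mem_some_iff] at hx
    simp only [List.head?_cons, Option.mem_some_iff] at hy
    subst hx hy; rw [lmB]; exact hbe
  have cmDe : (m :: (D ++ [e])).IsChain hvGraph.Adj := by
    rw [← List.cons_append]
    refine List.IsChain.append cmD (List.isChain_singleton e) fun x hx y hy => ?_
    rw [List.getLast?_eq_getLast_of_ne_nil (List.cons_ne_nil _ _), Option.mem_some_iff] at hx
    simp only [List.head?_cons, Option.mem_some_iff] at hy
    subst hx hy; rw [lmD]; exact hbe
  -- normal form of the goal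
  simp only [List.append_assoc, List.cons_append]
  -- Case 1: the two paths share their first step
  by_cases h0 : A = [] ∧ C = []
  · obtain ⟨rfl, rfl⟩ := h0
    simp only [List.nil_append]
    have hcard : (V \ [v₀].toFinset).card < n := by
      rw [← hV]
      refine Finset.card_lt_card ⟨Finset.sdiff_subset, fun h => ?_⟩
      have := h hv₀
      simp at this
    have hN' : ∀ v ∈ V \ [v₀].toFinset, v.1 ≤ N := fun v hv => hN v (Finset.mem_sdiff.1 hv).1
    have hconn' := far_of_sdiff hconn hs [v₀] (List.cons_ne_nil _ _) (List.isChain_singleton _)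
      (by simpa using hsv)
    have hv₀m : hvGraph.Adj v₀ m := by
      have := cPm; simp only [List.nil_append] at this
      exact (List.isChain_cons_cons.1 this).1
    have key := ih _ hcard (V \ [v₀].toFinset) rfl N hN' hconn' v₀ m vb e (by simp) (by simp [he])
      hv₀m hbe B D cmB nmB ?_ lmB cmD nmD ?_ lmD
    · rw [pturn_cons₃, pturn_cons₃, key]
    · intro x hx
      simp only [Finset.mem_sdiff, List.toFinset_cons, List.toFinset_nil, insert_empty_eq,
        Finset.mem_singleton]
      rcases List.mem_cons.1 hx with rfl | hx
      · exact ⟨hmV, hmv₀⟩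
      · exact ⟨hBV x hx, fun h => hv₀B (h ▸ hx)⟩
    · intro x hx
      simp only [Finset.mem_sdiff, List.toFinset_cons, List.toFinset_nil, insert_empty_eq,
        Finset.mem_singleton]
      rcases List.mem_cons.1 hx with rfl | hx
      · exact ⟨hmV, hmv₀⟩
      · exact ⟨hDV x hx, fun h => hv₀D (h ▸ hx)⟩
  -- Case 2: the lens
  -- the named vertices
  set p₁ : HV := (A ++ [m]).head (by simp) with hp₁
  set q₁ : HV := (C ++ [m]).head (by simp) with hq₁
  set A₀ : HV := (v₀ :: A).getLast (List.cons_ne_nil _ _) with hA₀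
  set B₀ : HV := (v₀ :: C).getLast (List.cons_ne_nil _ _) with hB₀
  set z : HV := (D ++ [e]).head (by simp) with hz
  -- adjacencies at `v₀`
  have hv₀p₁ : hvGraph.Adj v₀ p₁ := by
    have h := cPm
    obtain ⟨x, L, hxL⟩ := List.exists_cons_of_ne_nil (show A ++ [m] ≠ [] by simp)
    rw [hxL] at h
    have : p₁ = x := by rw [hp₁]; simp [hxL]
    rw [this]; exact (List.isChain_cons_cons.1 h).1
  have hv₀q₁ : hvGraph.Adj v₀ q₁ := by
    have h := cQm
    obtain ⟨x, L, hxL⟩ := List.exists_cons_of_ne_nil (show C ++ [m] ≠ [] by simp)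
    rw [hxL] at h
    have : q₁ = x := by rw [hq₁]; simp [hxL]
    rw [this]; exact (List.isChain_cons_cons.1 h).1
  -- adjacencies at `m`
  have hA₀m : hvGraph.Adj A₀ m := by
    have h := List.isChain_append.1 (show ((v₀ :: A) ++ [m]).IsChain hvGraph.Adj from cPm)
    exact h.2.2 A₀ (by rw [hA₀, List.getLast?_eq_getLast_of_ne_nil]; rfl) m rfl
  have hB₀m : hvGraph.Adj B₀ m := by
    have h := List.isChain_append.1 (show ((v₀ :: C) ++ [m]).IsChain hvGraph.Adj from cQm)
    exact h.2.2 B₀ (by rw [hB₀, List.getLast?_eq_getLast_of_ne_nil]; rfl) m rfl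
  have hmz : hvGraph.Adj m z := by
    have h := cmDe
    obtain ⟨x, L, hxL⟩ := List.exists_cons_of_ne_nil (show D ++ [e] ≠ [] by simp)
    rw [hxL] at h
    have : z = x := by rw [hz]; simp [hxL]
    rw [this]; exact (List.isChain_cons_cons.1 h).1
  -- where the named vertices live
  have hp₁_mem : p₁ ∈ A ++ [m] := List.head_mem _
  have hq₁_mem : q₁ ∈ C ++ [m] := List.head_mem _
  have hA₀_mem : A₀ ∈ v₀ :: A := List.getLast_mem _
  have hB₀_mem : B₀ ∈ v₀ :: C := List.getLast_mem _
  have hz_mem : z ∈ D ++ [e] := List.head_mem _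
  have hp₁V : p₁ ∈ V := by
    rcases List.mem_append.1 hp₁_mem with h | h
    · exact hAV _ h
    · simp at h; exact h ▸ hmV
  have hq₁V : q₁ ∈ V := by
    rcases List.mem_append.1 hq₁_mem with h | h
    · exact hCV _ h
    · simp at h; exact h ▸ hmV
  have hA₀V : A₀ ∈ V := by
    rcases List.mem_cons.1 hA₀_mem with h | h
    · exact h ▸ hv₀
    · exact hAV _ h
  have hB₀V : B₀ ∈ V := by
    rcases List.mem_cons.1 hB₀_mem with h | h
    · exact h ▸ hv₀
    · exact hCV _ h
  -- distinctness at `v₀`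
  have hp₁q₁ : p₁ ≠ q₁ := by
    intro hpq
    rcases eq_or_ne A [] with hA | hA
    · have hC : C ≠ [] := fun hC => h0 ⟨hA, hC⟩
      have hp : p₁ = m := by rw [hp₁]; simp [hA]
      have hq : q₁ ∈ C := by
        obtain ⟨c, C', hc⟩ := List.exists_cons_of_ne_nil hC
        rw [hq₁]; simp [hc]
      exact hmC (hp ▸ hpq ▸ hq)
    · have hp : p₁ ∈ A := by
        obtain ⟨a, A', ha⟩ := List.exists_cons_of_ne_nil hA
        rw [hp₁]; simp [ha]
      refine hAQ p₁ hp ?_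
      rw [hpq]
      rcases List.mem_append.1 hq₁_mem with h | h
      · simp [h]
      · simp at h; simp [h]
  have hp₁s : p₁ ≠ s := fun h => hs (h ▸ hp₁V)
  have hq₁s : q₁ ≠ s := fun h => hs (h ▸ hq₁V)
  -- distinctness at `m`
  have hA₀B₀ : A₀ ≠ B₀ := by
    intro hab
    rcases eq_or_ne A [] with hA | hA
    · have hC : C ≠ [] := fun hC => h0 ⟨hA, hC⟩
      have ha : A₀ = v₀ := by rw [hA₀]; simp [hA]
      have hb : B₀ ∈ C := by
        rw [hB₀, List.getLast_cons hC]; exact List.getLast_mem hC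
      exact hv₀C (ha ▸ hab ▸ hb)
    · have ha : A₀ ∈ A := by
        rw [hA₀, List.getLast_cons hA]; exact List.getLast_mem hA
      refine hAQ A₀ ha ?_
      rw [hab]
      rcases List.mem_cons.1 hB₀_mem with h | h
      · simp [h]
      · simp [h]
  have hzA₀ : z ≠ A₀ := by
    intro hza
    rcases List.mem_append.1 hz_mem with h | h
    · rcases List.mem_cons.1 hA₀_mem with h' | h'
      · exact hv₀D (h' ▸ hza ▸ h)
      · exact hAD _ h' (hza ▸ h)
    · simp at h; exact he (h ▸ hza ▸ hA₀V)
  have hzB₀ : z ≠ B₀ := by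
    intro hzb
    rcases List.mem_append.1 hz_mem with h | h
    · rcases List.mem_cons.1 hB₀_mem with h' | h'
      · exact hv₀D (h' ▸ hzb ▸ h)
      · exact hCD _ h' (hzb ▸ h)
    · simp at h; exact he (h ▸ hzb ▸ hB₀V)
  -- the cycle `v₀ → A → m → reverse C → v₀`
  set Cyc : List HV := v₀ :: (A ++ m :: C.reverse) with hCyc
  have hCyc3 : 3 ≤ Cyc.length := by
    rw [hCyc]
    simp only [List.length_cons, List.length_append, List.length_reverse]
    rcases eq_or_ne A [] with hA | hA
    · have hC : C ≠ [] := fun hC => h0 ⟨hA, hC⟩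
      have := List.length_pos_of_ne_nil hC
      omega
    · have := List.length_pos_of_ne_nil hA
      omega
  have hmCrev : m :: C.reverse = (C ++ [m]).reverse := by simp
  have cmC : (m :: C.reverse).IsChain hvGraph.Adj := by
    rw [hmCrev, List.isChain_reverse]
    have h : (C ++ [m]).IsChain hvGraph.Adj := by
      have := cQm
      rw [List.isChain_cons] at this
      exact this.2
    exact h.imp fun a b hab => hab.symm
  have cCyc : Cyc.IsChain hvGraph.Adj := by
    rw [hCyc, List.isChain_cons_split]
    exact ⟨cPm, cmC⟩
  have hCyc_last : Cyc.getLast (by rw [hCyc]; exact List.cons_ne_nil _ _) = q₁ := by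
    have h1 : Cyc = (v₀ :: A) ++ (C ++ [m]).reverse := by rw [hCyc, ← hmCrev]; simp
    simp only [h1, List.getLast_append_of_ne_nil _ (by simp : (C ++ [m]).reverse ≠ []),
      List.getLast_reverse, hq₁]
  have hCyc_darts : ∀ d ∈ cdarts Cyc, hvGraph.Adj d.1 d.2 := by
    intro d hd
    rw [hCyc, cdarts_cons, List.mem_append, List.mem_singleton] at hd
    rcases hd with hd | rfl
    · exact adj_of_mem_pdarts cCyc _ hd
    · simp only
      have : (v₀ :: (A ++ m :: C.reverse)).getLast (List.cons_ne_nil _ _) = q₁ := hCyc_last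
      rw [this]
      exact hv₀q₁.symm
  have hCyc_nodup : Cyc.Nodup := by
    rw [hCyc, List.nodup_cons]
    refine ⟨?_, ?_⟩
    · simp only [List.mem_append, List.mem_cons, List.mem_reverse, not_or]
      exact ⟨hv₀A, hmv₀.symm, hv₀C⟩
    · rw [List.nodup_middle, List.nodup_cons]
      refine ⟨?_, List.Nodup.append nA (List.nodup_reverse.2 nC) ?_⟩
      · simp only [List.mem_append, List.mem_reverse, not_or]
        exact ⟨hmA, hmC⟩
      · intro x hxA hxC
        exact hAC x hxA (List.mem_reverse.1 hxC)
  have hIsCyc : IsCyc Cyc := ⟨hCyc3, hCyc_nodup, hCyc_darts⟩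
  have hCycV : ∀ w ∈ Cyc, w ∈ V := by
    intro w hw
    rw [hCyc] at hw
    simp only [List.mem_cons, List.mem_append, List.mem_reverse] at hw
    rcases hw with rfl | hw | rfl | hw
    · exact hv₀
    · exact hAV _ hw
    · exact hmV
    · exact hCV _ hw
  have hCycN : ∀ w ∈ Cyc, w.1 ≤ N := fun w hw => hN w (hCycV w hw)
  -- first application of the loop lemma: at `v₀`, seen from `s`
  have hsCyc : s ∉ Cyc := fun h => hs (hCycV s h)
  obtain ⟨Ws, hWs, hcs, hhs, havs, hfars, hups⟩ := hconn s hs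
  have h0s : wnd Cyc (leftFace v₀ s) = 0 := by
    have := wnd_rightFace_eq_zero_of_far hCyc_darts hCycN Ws hWs hcs
      (fun w hw hw' => havs w hw (hCycV w hw')) hfars hups (t := v₀) (by rw [hhs]; exact hsv)
    rw [hhs] at this
    exact this
  have hL : A ++ m :: C.reverse ≠ [] := by simp
  have app₁ := cturn_eq_neg_six_mul_turn (v := v₀) (L := A ++ m :: C.reverse) hIsCyc hL
    hsv.symm hsCyc h0s
  have hLhead : (A ++ m :: C.reverse).head hL = p₁ := by
    rw [hp₁]; exact head_append_cons A m C.reverse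
  rw [hLhead] at app₁
  -- second application: at `m`, seen from `z`
  set Cyc₂ : List HV := m :: (C.reverse ++ v₀ :: A) with hCyc₂
  have hrot : Cyc₂ = Cyc.rotate (v₀ :: A).length := by
    have h1 : Cyc = (v₀ :: A) ++ (m :: C.reverse) := by rw [hCyc]; simp
    rw [h1, List.rotate_append_length_eq, hCyc₂]; simp
  have hIsCyc₂ : IsCyc Cyc₂ := hrot ▸ hIsCyc.rotate _
  have hcturn₂ : cturn Cyc₂ = cturn Cyc := by rw [hrot]; exact cturn_rotate hCyc3 _
  have hmem₂ : ∀ w, w ∈ Cyc₂ ↔ w ∈ Cyc := fun w => by rw [hrot]; exact List.mem_rotate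
  have hzCyc : z ∉ Cyc := by
    intro h
    rw [hCyc] at h
    simp only [List.mem_cons, List.mem_append, List.mem_reverse] at h
    rcases List.mem_append.1 hz_mem with hzD | hze
    · rcases h with h | h | h | h
      · exact hv₀D (h ▸ hzD)
      · exact hAD _ h hzD
      · exact hmD (h ▸ hzD)
      · exact hCD _ h hzD
    · simp at hze
      rw [hze] at h
      rcases h with h | h | h | h
      · exact he (h ▸ hv₀)
      · exact he (hAV _ h)
      · exact he (h ▸ hmV)
      · exact he (hCV _ h)
  obtain ⟨We, hWe, hce, hhe, have', hfare, hupe⟩ := hconn e he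
  obtain ⟨We', rfl⟩ : ∃ We', We = e :: We' := by
    obtain ⟨w, We', rfl⟩ := List.exists_cons_of_ne_nil hWe
    exact ⟨We', by rw [List.head_cons] at hhe; rw [hhe]⟩
  have hWz_ne : D ++ e :: We' ≠ [] := by simp
  have hWz_head : (D ++ e :: We').head hWz_ne = z := by
    rw [hz]; exact head_append_cons D e We'
  have hWz_chain : (D ++ e :: We').IsChain hvGraph.Adj := by
    have h1 : (m :: (D ++ e :: We')).IsChain hvGraph.Adj := by
      rw [List.isChain_cons_split]
      exact ⟨cmDe, hce⟩
    exact h1.tail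
  have hWz_av : ∀ w ∈ D ++ e :: We', w ∉ Cyc₂ := by
    intro w hw hw'
    rw [hmem₂] at hw'
    rcases List.mem_append.1 hw with hwD | hwW
    · rw [hCyc] at hw'
      simp only [List.mem_cons, List.mem_append, List.mem_reverse] at hw'
      rcases hw' with h | h | h | h
      · exact hv₀D (h ▸ hwD)
      · exact hAD _ h hwD
      · exact hmD (h ▸ hwD)
      · exact hCD _ h hwD
    · exact have' w hwW (hCycV w hw')
  have hWz_last : (D ++ e :: We').getLast hWz_ne = (e :: We').getLast (List.cons_ne_nil _ _) :=
    List.getLast_append_of_ne_nil _ _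
  have h0z : wnd Cyc₂ (leftFace m z) = 0 := by
    have hd₂ : ∀ d ∈ cdarts Cyc₂, hvGraph.Adj d.1 d.2 := hIsCyc₂.2.2
    have hN₂ : ∀ w ∈ Cyc₂, w.1 ≤ N := fun w hw => hCycN w ((hmem₂ w).1 hw)
    have := wnd_rightFace_eq_zero_of_far hd₂ hN₂ (D ++ e :: We') hWz_ne hWz_chain hWz_av
      (by rw [hWz_last]; exact hfare) (by rw [hWz_last]; exact hupe) (t := m)
      (by rw [hWz_head]; exact hmz.symm)
    rw [hWz_head] at this
    exact this
  have hzCyc₂ : z ∉ Cyc₂ := fun h => hzCyc ((hmem₂ z).1 h)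
  have hL₂ : C.reverse ++ v₀ :: A ≠ [] := by simp
  have app₂ := cturn_eq_neg_six_mul_turn (v := m) (L := C.reverse ++ v₀ :: A) hIsCyc₂ hL₂
    hmz hzCyc₂ h0z
  have hL₂head : (C.reverse ++ v₀ :: A).head hL₂ = B₀ := by
    rw [head_append_cons C.reverse v₀ A, hB₀]
    have : C.reverse ++ [v₀] = (v₀ :: C).reverse := by simp
    simp only [this, List.head_reverse]
  rw [hL₂head, hcturn₂] at app₂
  -- the turning number of the cycle, split along the two arcs
  have hsplit := cturn_cons_append_cons v₀ m A C.reverse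
  have e_q₁ : (m :: C.reverse).getLast (List.cons_ne_nil _ _) = q₁ := by
    simp only [hmCrev, List.getLast_reverse, hq₁]
  have e_rev : m :: (C.reverse ++ [v₀]) = (v₀ :: (C ++ [m])).reverse := by simp
  have e_B₀ : (C.reverse ++ [v₀]).head (by simp) = B₀ := by
    have : C.reverse ++ [v₀] = (v₀ :: C).reverse := by simp
    simp only [this, List.head_reverse, hB₀]
  have hPC : pturn (A₀ :: m :: (C.reverse ++ [v₀])) =
      turn A₀ m B₀ - pturn (v₀ :: (C ++ [m])) := by
    rw [pturn_cons_cons_append _ _ _ (by simp), e_B₀, e_rev, pturn_reverse]; ring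
  rw [e_q₁, ← hp₁, ← hA₀, hPC] at hsplit
  -- i.e. `cturn Cyc = turn q₁ v₀ p₁ + pturn (v₀ :: (A ++ [m])) + (turn A₀ m B₀ - pturn (v₀ :: (C ++ [m])))`
  have hsplit' : cturn Cyc = turn q₁ v₀ p₁ + pturn (v₀ :: (A ++ [m])) +
      (turn A₀ m B₀ - pturn (v₀ :: (C ++ [m]))) := hsplit
  -- the two totals, split at `m`
  have hTP : pturn (s :: v₀ :: (A ++ m :: (B ++ [e]))) =
      turn s v₀ p₁ + pturn (v₀ :: (A ++ [m])) + pturn (A₀ :: m :: (B ++ [e])) := by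
    have h1 := pturn_append_cons_getLast (s :: v₀ :: A) (B ++ [e]) (List.cons_ne_nil _ _) m
    have h2 : (s :: v₀ :: A).getLast (List.cons_ne_nil _ _) = A₀ := by
      rw [hA₀, List.getLast_cons (List.cons_ne_nil _ _)]
    have h3 : pturn (s :: v₀ :: (A ++ [m])) = turn s v₀ p₁ + pturn (v₀ :: (A ++ [m])) := by
      rw [pturn_cons_cons_append _ _ _ (by simp), hp₁]
    simp only [List.cons_append] at h1
    rw [h1, h2, h3]
  have hTQ : pturn (s :: v₀ :: (C ++ m :: (D ++ [e]))) =
      turn s v₀ q₁ + pturn (v₀ :: (C ++ [m])) + pturn (B₀ :: m :: (D ++ [e])) := by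
    have h1 := pturn_append_cons_getLast (s :: v₀ :: C) (D ++ [e]) (List.cons_ne_nil _ _) m
    have h2 : (s :: v₀ :: C).getLast (List.cons_ne_nil _ _) = B₀ := by
      rw [hB₀, List.getLast_cons (List.cons_ne_nil _ _)]
    have h3 : pturn (s :: v₀ :: (C ++ [m])) = turn s v₀ q₁ + pturn (v₀ :: (C ++ [m])) := by
      rw [pturn_cons_cons_append _ _ _ (by simp), hq₁]
    simp only [List.cons_append] at h1
    rw [h1, h2, h3]
  -- the tails from `m`, by induction in `V` minus the first arc of `P`
  have hIH : pturn (A₀ :: m :: (B ++ [e])) = pturn (A₀ :: m :: (D ++ [e])) := by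
    have hsub : (v₀ :: A).toFinset ⊆ V := by
      intro x hx
      rw [List.mem_toFinset] at hx
      rcases List.mem_cons.1 hx with rfl | hx
      · exact hv₀
      · exact hAV x hx
    have hcard : (V \ (v₀ :: A).toFinset).card < n := by
      rw [← hV]
      refine Finset.card_lt_card ⟨Finset.sdiff_subset, fun h => ?_⟩
      have := h hv₀
      simp at this
    have hN' : ∀ v ∈ V \ (v₀ :: A).toFinset, v.1 ≤ N := fun v hv => hN v (Finset.mem_sdiff.1 hv).1
    have cA : (v₀ :: A).IsChain hvGraph.Adj :=
      (List.isChain_append.1 (show ((v₀ :: A) ++ [m]).IsChain hvGraph.Adj from cPm)).1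
    have hconn' := far_of_sdiff hconn hs (v₀ :: A) (List.cons_ne_nil _ _) cA (by simpa using hsv)
    have hA₀' : A₀ ∉ V \ (v₀ :: A).toFinset := by
      rw [Finset.mem_sdiff, not_and, not_not, List.mem_toFinset]
      exact fun _ => hA₀_mem
    have he' : e ∉ V \ (v₀ :: A).toFinset := fun h => he (Finset.mem_sdiff.1 h).1
    have smB : ∀ x ∈ m :: B, x ∈ V \ (v₀ :: A).toFinset := by
      intro x hx
      rw [Finset.mem_sdiff, List.mem_toFinset, List.mem_cons, not_or]
      rcases List.mem_cons.1 hx with rfl | hx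
      · exact ⟨hmV, hmv₀, hmA⟩
      · exact ⟨hBV x hx, fun h => hv₀B (h ▸ hx), hBA x hx⟩
    have smD : ∀ x ∈ m :: D, x ∈ V \ (v₀ :: A).toFinset := by
      intro x hx
      rw [Finset.mem_sdiff, List.mem_toFinset, List.mem_cons, not_or]
      rcases List.mem_cons.1 hx with rfl | hx
      · exact ⟨hmV, hmv₀, hmA⟩
      · exact ⟨hDV x hx, fun h => hv₀D (h ▸ hx), fun h => hAD _ h hx⟩
    exact ih _ hcard (V \ (v₀ :: A).toFinset) rfl N hN' hconn' A₀ m vb e hA₀' he' hA₀m hbe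
      B D cmB nmB smB lmB cmD nmD smD lmD
  -- peel the turn at `m` off the tails
  have hTB : pturn (A₀ :: m :: (D ++ [e])) = turn A₀ m z + pturn (m :: (D ++ [e])) := by
    rw [pturn_cons_cons_append _ _ _ (by simp), hz]
  have hTD : pturn (B₀ :: m :: (D ++ [e])) = turn B₀ m z + pturn (m :: (D ++ [e])) := by
    rw [pturn_cons_cons_append _ _ _ (by simp), hz]
  -- local identities at the trivalent vertices `v₀` and `m`
  have t1 : turn s v₀ q₁ = -turn s v₀ p₁ :=
    turn_eq_neg_turn_of_ne hsv.symm hv₀q₁ hv₀p₁ hq₁s hp₁s hp₁q₁.symm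
  have t2 : turn q₁ v₀ p₁ = -turn q₁ v₀ s :=
    turn_eq_neg_turn_of_ne hv₀q₁ hv₀p₁ hsv.symm hp₁q₁ hq₁s.symm hp₁s
  have t3 : turn q₁ v₀ s = -turn s v₀ q₁ := turn_rev _ _ _
  have t4 : turn z m A₀ = -turn z m B₀ :=
    turn_eq_neg_turn_of_ne hmz hA₀m.symm hB₀m.symm hzA₀.symm hzB₀.symm hA₀B₀
  have t5 : turn A₀ m z = -turn z m A₀ := turn_rev _ _ _
  have t6 : turn A₀ m B₀ = -turn A₀ m z :=
    turn_eq_neg_turn_of_ne hA₀m.symm hB₀m.symm hmz hA₀B₀.symm hzA₀ hzB₀.symm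
  have t7 : turn B₀ m z = -turn z m B₀ := turn_rev _ _ _
  -- books
  rw [hTP, hTQ, hIH, hTB, hTD]
  linarith

end HV

/-! ### Transport to walks between mid-edges of `hexGraph` -/

section Transport

open HV

variable {Λ : Finset HexVertex} {a : Sym2 HexVertex} {u w₁ v t : HexVertex}
  {Φ : hexGraph ≃g hvGraph} {α β : ℂ}

/-- **The winding of a nontrivial walk is `(π/3) · pturn` of its code** (the chart is a
similarity, turns of the honeycomb lattice are `±π/3`, and the end half-edges do not turn;
extracted from the proof of `HexMidEdgeSAW.weight_eq_pwt`). [cite: DuminilCopinSmirnov2012, §2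
(winding = total rotation of the direction)] -/
theorem HexMidEdgeSAW.winding_eq_pturn_code (γ : HexMidEdgeSAW Λ a s(v, t)) (ha : a = s(u, w₁))
    (hu : u ∉ Λ) (hΦu : Φ u = wOut) (hΦw : Φ w₁ = hvOrigin) (hvt : hexGraph.Adj v t)
    (haff : ∀ f, emb (pos (Φ f)) = α * hexCenter f + β) (hα : α ≠ 0)
    (hne : γ.verts ≠ []) {e : HexVertex}
    (he : (γ.verts.getLast hne = v ∧ e = t) ∨ (γ.verts.getLast hne = t ∧ e = v)) :
    γ.winding = (Real.pi / 3) * pturn (wOut :: (γ.verts.map Φ ++ [Φ e])) := by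
  have hmw := γ.isMidWalk_code Φ ha hu hΦu hΦw hvt hne he
  set m := γ.verts.map Φ with hm
  have hmne : m ≠ [] := by simpa [hm] using hne
  have hcode : wOut :: (m ++ [Φ e]) = (u :: (γ.verts ++ [e])).map Φ := by
    simp [hm, hΦu]
  have hc : ∀ f, hexCenter f = α⁻¹ * emb (pos (Φ f)) + -(β / α) := by
    intro f; rw [haff]; field_simp; ring
  rw [γ.winding_eq_winding_map ha hu hne he]
  have e1 : (u :: (γ.verts ++ [e])).map hexCenter =
      (((u :: (γ.verts ++ [e])).map Φ).map fun y => emb (pos y)).map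
        fun z => α⁻¹ * z + -(β / α) := by
    simp only [List.map_map]
    exact List.map_congr_left fun f _ => hc f
  rw [e1, winding_map_affine (inv_ne_zero hα), ← hcode]
  refine winding_map_emb_pos _ hmw.1 ?_
  -- no backtracking in the code
  have hQ : (wOut :: m).Nodup := by
    refine List.nodup_cons.2 ⟨fun h => hu ?_, γ.nodup.map Φ.injective⟩
    rw [hm, ← hΦu, List.mem_map] at h
    obtain ⟨y, hy, hyu⟩ := h
    exact Φ.injective hyu ▸ γ.subset y hy
  have hnb : ∀ (i : ℕ) (hi : i + 2 < ((wOut :: m) ++ [Φ e]).length),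
      ((wOut :: m) ++ [Φ e])[i] ≠ ((wOut :: m) ++ [Φ e])[i + 2] := by
    intro i hi
    by_cases h2 : i + 2 < (wOut :: m).length
    · rw [List.getElem_append_left (by omega), List.getElem_append_left h2]
      intro h
      have := (hQ.getElem_inj_iff).1 h
      omega
    · have hlen : i + 2 = (wOut :: m).length := by
        simp only [List.length_append, List.length_singleton] at hi
        omega
      rw [List.getElem_append_left (by omega), List.getElem_concat_length hlen,
        ← prevOf_eq_getElem_cons hmne (by omega) (by simp at hlen; omega)]
      exact (γ.map_ne_prevOf ha hu hΦu hne he).symm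
  exact hnb

/-- **Rigidity of the winding between boundary mid-edges**: in a simply connected domain of the
honeycomb lattice (connected complement), all self-avoiding walks from a boundary mid-edge `a`
to a boundary mid-edge `b` have the same winding `W_γ(a, b)` (DCS evaluate these windings by
their common value, e.g. "the winding of any self-avoiding walk from `a` to the bottom part of
`α` is `-π` while the winding to the top part is `π`"). Proof: code the walks in the coordinate
model by a chart taking `a` to the standard entrance (`exists_chart`); the winding is `(π/3)`
times the turning of the code (`winding_eq_pturn_code`), and the turnings agree by
`HV.pturn_eq_pturn_of_paths`, the complement of `Φ(Λ)` being joined to the far right along the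
image of a path of `Λᶜ`. [cite: DuminilCopinSmirnov2012, §3 proof of Lemma 2] -/
theorem HexMidEdgeSAW.winding_eq_of_mem_boundary (hΛ : hexDomainSimplyConnected Λ)
    {a b : Sym2 HexVertex} (ha : a ∈ hexDomainBoundary Λ) (hb : b ∈ hexDomainBoundary Λ)
    (γ γ' : HexMidEdgeSAW Λ a b) : γ.winding = γ'.winding := by
  classical
  by_cases hab : a = b
  · subst hab
    have h1 := HexMidEdgeSAW.verts_eq_nil_of_mem_boundary ha γ
    have h2 := HexMidEdgeSAW.verts_eq_nil_of_mem_boundary ha γ'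
    rw [HexMidEdgeSAW.ext (h1.trans h2.symm)]
  obtain ⟨haE, u, w₁, rfl, hw₁, hu⟩ := ha
  obtain ⟨hbE, u', w', rfl, hw', hu'⟩ := hb
  have huw : hexGraph.Adj u w₁ := (SimpleGraph.mem_edgeSet hexGraph).1 haE
  have huw' : hexGraph.Adj u' w' := (SimpleGraph.mem_edgeSet hexGraph).1 hbE
  have hne : γ.verts ≠ [] := fun h => hab (γ.eq_of_nil h)
  have hne' : γ'.verts ≠ [] := fun h => hab (γ'.eq_of_nil h)
  obtain ⟨Φ, α, β, hα, hΦu, hΦw, haff⟩ := exists_chart huw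
  -- the last vertex of a walk to the boundary mid-edge `{u', w'}` is `w'`
  have hlast : γ.verts.getLast hne = w' := by
    rcases γ.getLast_eq_or hne with h | h
    · exact absurd (h ▸ γ.subset _ (List.getLast_mem hne)) hu'
    · exact h
  have hlast' : γ'.verts.getLast hne' = w' := by
    rcases γ'.getLast_eq_or hne' with h | h
    · exact absurd (h ▸ γ'.subset _ (List.getLast_mem hne')) hu'
    · exact h
  rw [γ.winding_eq_pturn_code rfl hu hΦu hΦw huw' haff hα hne (e := u') (Or.inr ⟨hlast, rfl⟩),
    γ'.winding_eq_pturn_code rfl hu hΦu hΦw huw' haff hα hne' (e := u') (Or.inr ⟨hlast', rfl⟩)]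
  congr 1
  -- the coordinate data
  set V := Λ.map Φ.toEquiv.toEmbedding with hV
  have hmemV : ∀ x, x ∈ V ↔ Φ.symm x ∈ Λ := by
    intro x
    rw [hV, Finset.mem_map]
    constructor
    · rintro ⟨y, hy, rfl⟩
      change Φ.symm (Φ y) ∈ Λ
      rw [RelIso.symm_apply_apply]; exact hy
    · intro h
      exact ⟨Φ.symm x, h, RelIso.apply_symm_apply Φ x⟩
  have hmemV' : ∀ y, Φ y ∈ V ↔ y ∈ Λ := by
    intro y; rw [hmemV, RelIso.symm_apply_apply]
  obtain ⟨N, hN⟩ := Finset.exists_le (V.image fun x : HV => x.1)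
  have hN' : ∀ x ∈ V, x.1 ≤ N := fun x hx => hN _ (Finset.mem_image_of_mem _ hx)
  -- the complement of `V` is joined to the far right
  have hconn : ∀ x ∉ V, ∃ (W : List HV) (hW : W ≠ []), W.IsChain hvGraph.Adj ∧ W.head hW = x ∧
      (∀ w ∈ W, w ∉ V) ∧ N < (W.getLast hW).1 ∧ (W.getLast hW).2.2 = false := by
    intro x hx
    set y' : HV := (N + 1, 0, false) with hy'
    have hy'V : y' ∉ V := fun h => by have := hN' _ h; simp [hy'] at this
    have hx₀ : Φ.symm x ∉ Λ := fun h => hx ((hmemV x).2 h)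
    have hy₀ : Φ.symm y' ∉ Λ := fun h => hy'V ((hmemV y').2 h)
    obtain ⟨W⟩ := hΛ ⟨Φ.symm x, by simpa using hx₀⟩ ⟨Φ.symm y', by simpa using hy₀⟩
    set Q : List HV := W.support.map fun z => Φ z.1 with hQ
    have hQne : Q ≠ [] := by simp [hQ]
    have hQc : Q.IsChain hvGraph.Adj := by
      rw [hQ, List.isChain_map]
      exact List.IsChain.imp (fun p q h => (Φ.map_rel_iff).2 h) W.isChain_adj_support
    have hQV : ∀ z ∈ Q, z ∉ V := by
      intro z hz hzV
      obtain ⟨p, -, rfl⟩ := List.mem_map.1 hz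
      exact p.2 ((hmemV' p.1).1 hzV)
    have hQhead : Q.head hQne = x := by
      have : Q = Φ (Φ.symm x) :: (W.support.tail.map fun z => Φ z.1) := by
        rw [hQ, ← W.cons_tail_support]; rfl
      simp only [this, List.head_cons, RelIso.apply_symm_apply]
    have hQlast : Q.getLast hQne = y' := by
      have h1 : Q.getLast hQne = Φ (Φ.symm y') := by
        simp [hQ, List.getLast_map, W.getLast_support]
      rw [h1, RelIso.apply_symm_apply]
    refine ⟨Q, hQne, hQc, hQhead, hQV, ?_, ?_⟩
    · rw [hQlast, hy']; simp
    · rw [hQlast, hy']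
  -- entrance and exit
  have hs : wOut ∉ V := by rw [← hΦu, hmemV']; exact hu
  have he : Φ u' ∉ V := by rw [hmemV']; exact hu'
  have hbe : hvGraph.Adj (Φ w') (Φ u') := (Φ.map_rel_iff).2 huw'.symm
  -- the two coded paths
  have hpath : ∀ (δ : HexMidEdgeSAW Λ s(u, w₁) s(u', w')) (hδ : δ.verts ≠ [])
      (hδl : δ.verts.getLast hδ = w'), ∃ T : List HV,
      δ.verts.map Φ = hvOrigin :: T ∧ (hvOrigin :: T).IsChain hvGraph.Adj ∧
        (hvOrigin :: T).Nodup ∧ (∀ x ∈ hvOrigin :: T, x ∈ V) ∧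
        (hvOrigin :: T).getLast (List.cons_ne_nil _ _) = Φ w' := by
    intro δ hδ hδl
    obtain ⟨x, T₀, hxT⟩ := List.exists_cons_of_ne_nil hδ
    have hx : x = w₁ := by
      have := δ.head_eq rfl hu hδ
      rw [← this]; simp [hxT]
    subst hx
    have hcode : δ.verts.map Φ = hvOrigin :: T₀.map Φ := by rw [hxT, List.map_cons, hΦw]
    refine ⟨T₀.map Φ, hcode, ?_, ?_, ?_, ?_⟩
    · rw [← hcode, List.isChain_map]
      exact List.IsChain.imp (fun p q h => (Φ.map_rel_iff).2 h) δ.isChain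
    · rw [← hcode]; exact δ.nodup.map Φ.injective
    · rw [← hcode]
      intro y hy
      obtain ⟨z, hz, rfl⟩ := List.mem_map.1 hy
      exact (hmemV' z).2 (δ.subset z hz)
    · have h1 : (δ.verts.map Φ).getLast (by simpa using hδ) = Φ w' := by
        rw [List.getLast_map, hδl]
      simp only [hcode] at h1
      exact h1
  obtain ⟨T, hT, cT, nT, sT, lT⟩ := hpath γ hne hlast
  obtain ⟨T', hT', cT', nT', sT', lT'⟩ := hpath γ' hne' hlast'
  rw [hT, hT']
  simp only [List.cons_append]
  exact_mod_cast pturn_eq_pturn_of_paths V.card V rfl N hN' hconn wOut hvOrigin (Φ w') (Φ u')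
    hs he adj_wOut_hvOrigin hbe T T' cT nT sT lT cT' nT' sT' lT'

end Transport

end Literature.Probability.RandomPlanarGeometry.SAW
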